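import Mathlib
import Literature.Probability.Percolation.TwoClusterConditionalAssociation
import Summits.CriticalPhenomena.PercolationContinuityZ3.Theorems.PercNearOneGluingAdditiveGluingPocketBHK
import HarnessLib

/-! # Crux `PercNearOneGluing.AdditiveGluing` (stmt-CriticalPhenomena-4576), line `subuniform-dead-pocket-maximum`,
# stub `stub_goodStep` — the pocket-augmented BHK inequality, IV: conditional-covariance (event) form

Helper file for the crux (prover-siege k9).  **Corollary (pocket-augmented conditional association;
new — `pocket_cov_event`, registered sub-goal `stub_pocketCovariance_k9`).**  For the product Bernoulli
measure `μ = prodBernoulli w` on bond configurations of a finite vertex type, vertices `s, o, b`, a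
forbidden set `Z`, and ANY family `R` of vertex sets each containing `o` and avoiding `s` and `Z`
("pockets"), with `D := {s ↮ Z}` and the pocket event `F := {o ↔ s} ∪ {C(o) ∈ R}`:
    `μ(D ∩ F) · μ(D ∩ {s ↔ b}) ≤ μ(D) · μ(D ∩ F ∩ {s ↔ b})`,
i.e. conditioned on `{s ↮ Z}`, `F` is positively correlated with `{s ↔ b}` (`R = ∅`: BHK Thm 1.2).
Equivalently `Σ_{pockets W} (P(s↔b)P(C(o)=W) − P(s↔b, C(o)=W))⁺ ≤ Cov_P(1{o↔s}, 1{s↔b})`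
(`P = μ(·|s↮Z)`): the positive correlation of `{o ↔ s}` with `{s ↔ b}` pays for ALL pockets of `o` that are
negatively correlated with `{s ↔ b}`.  It is `pocketCore` (file III) with `U = univ`, `X = Y = Z`,
`G = connIndicatorFn s b`, read through `prodBernoulli = Σ weight · δ` (`BHK2006.integral_prodBernoulli_eq_sum`).
With `s = a₁, Z = {a₂}` / `s = a₂, Z = {a₁}` and `b` the target these are the inequalities H1/H2 of the
lead's analysis of `stub_goodStep` (`…-goodstep-c1.md` §3), which give the kernel C1 and goodness with two
relays (paper proof: item evidence `PocketBHK-paper.md`, Thm C).  No definitions. -/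

namespace Summit.CriticalPhenomena.PercolationContinuityZ3.Theorems

namespace PocketBHK

open MeasureTheory
open Literature.Probability.LatticeModels (prodBernoulli)
open Literature.Probability.Percolation Literature.Probability.Percolation.BHK2006
open DecisionTree (ind ind_of_mem ind_of_not_mem ind_nonneg)
open scoped Classical

noncomputable section

variable {V : Type*} [Fintype V]

/-- `prodBernoulli w` of an event is the weighted count `Σ_ω weight(ω) 1_E(ω)`. [folklore] -/
theorem real_eq_sum_weight_ind (w : Sym2 V → unitInterval) (E : Set (Set (Sym2 V))) :
    (prodBernoulli w).real E = ∑ ω, weight (fun e => (w e : ℝ)) ω * ind E ω := by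
  have hEm : MeasurableSet E := MeasurableSet.of_discrete
  rw [← integral_indicator_one hEm, integral_prodBernoulli_eq_sum]
  refine Finset.sum_congr rfl fun ω _ => ?_
  by_cases hω : ω ∈ E
  · rw [Set.indicator_of_mem hω, ind_of_mem hω, Pi.one_apply]
  · rw [Set.indicator_of_notMem hω, ind_of_not_mem hω, mul_zero]

omit [Fintype V] in
/-- `connIndicatorFn ≥ 0`. [folklore] -/
theorem connIndicatorFn_nonneg (s a : V) (C : Set (Sym2 V)) : 0 ≤ connIndicatorFn s a C := by
  unfold connIndicatorFn
  split_ifs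
  · exact zero_le_one
  · exact le_rfl

omit [Fintype V] in
/-- `connIndicatorFn s b (C_s ω) = 1{s ↔ b}(ω)` as a real indicator. [folklore] -/
theorem connIndicatorFn_eq_ind (ω : Set (Sym2 V)) (s b : V) :
    connIndicatorFn s b (openEdgeCluster ω s) = ind (openConn s b : Set (Set (Sym2 V))) ω := by
  rw [connIndicatorFn_openEdgeCluster]
  by_cases h : ω ∈ (openConn s b : Set (Set (Sym2 V)))
  · rw [Set.indicator_of_mem h, ind_of_mem h, Pi.one_apply]
  · rw [Set.indicator_of_notMem h, ind_of_not_mem h]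

omit [Fintype V] in
/-- On the whole vertex set the restriction to `edgesIn univ` is void. [folklore] -/
theorem inter_edgesIn_univ (ω : Set (Sym2 V)) [Fintype V] : ω ∩ edgesIn (Finset.univ : Finset V) = ω := by
  ext e
  simp only [Set.mem_inter_iff, edgesIn, Set.mem_setOf_eq, Finset.mem_univ, imp_true_iff, and_true]

/-- **Pocket-augmented conditional association, event form** (new; see the module docstring): with
`D = {s ↮ Z}`, `F = {o ↔ s} ∪ {C(o) ∈ R}` for pockets `R` (each `W ∈ R` has `o ∈ W`, `s ∉ W`,
`W ∩ Z = ∅`): `μ(D ∩ F) μ(D ∩ {s↔b}) ≤ μ(D) μ(D ∩ F ∩ {s↔b})`. [folklore] -/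
theorem pocket_cov_event (w : Sym2 V → unitInterval) (s o b : V) (Z : Set V)
    (R : Set (Set V)) (hR : ∀ W ∈ R, o ∈ W ∧ s ∉ W ∧ ∀ z ∈ Z, z ∉ W) :
    (prodBernoulli w).real ({ω | ∀ z ∈ Z, ¬ (openGraph ω).Reachable s z} ∩
        {ω | (openGraph ω).Reachable o s ∨ openCluster ω o ∈ R}) *
      (prodBernoulli w).real ({ω | ∀ z ∈ Z, ¬ (openGraph ω).Reachable s z} ∩ openConn s b) ≤
    (prodBernoulli w).real {ω | ∀ z ∈ Z, ¬ (openGraph ω).Reachable s z} *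
      (prodBernoulli w).real ({ω | ∀ z ∈ Z, ¬ (openGraph ω).Reachable s z} ∩
        {ω | (openGraph ω).Reachable o s ∨ openCluster ω o ∈ R} ∩ openConn s b) := by
  set w' : Sym2 V → ℝ := fun e => (w e : ℝ) with hw'
  have hw0 : ∀ e, 0 ≤ w' e := fun e => (w e).2.1
  have hw1 : ∀ e, w' e ≤ 1 := fun e => (w e).2.2
  have hm : ∑ ω, weight w' ω = 1 := by
    have h1 := integral_prodBernoulli_eq_sum w fun _ => (1 : ℝ)
    simp only [integral_const, probReal_univ, smul_eq_mul, mul_one] at h1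
    exact h1.symm
  set D : Set (Set (Sym2 V)) := {ω | ∀ z ∈ Z, ¬ (openGraph ω).Reachable s z} with hD
  set F : Set (Set (Sym2 V)) := {ω | (openGraph ω).Reachable o s ∨ openCluster ω o ∈ R} with hF
  -- `U = univ`: the restricted objects are the original ones
  have hDD : rD (Finset.univ : Finset V) s Z = D := by
    ext ω; simp only [rD, inter_edgesIn_univ, hD, Set.mem_setOf_eq]
  have hFF : {ξ : Set (Sym2 V) | (openGraph (ξ ∩ edgesIn (Finset.univ : Finset V))).Reachable o s ∨
      openCluster (ξ ∩ edgesIn (Finset.univ : Finset V)) o ∈ R} = F := by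
    ext ω; simp only [inter_edgesIn_univ, hF, Set.mem_setOf_eq]
  have hC : ∀ ω, rC (Finset.univ : Finset V) s ω = openEdgeCluster ω s := fun ω => by
    simp only [rC, inter_edgesIn_univ]
  -- `pocketCore` with `X = Y = Z`, `P = (· ∈ R)`, `G = connIndicatorFn s b`
  have hZU : Z ⊆ ↑(Finset.univ : Finset V) := by simp
  have key := pocketCore w' hw0 hw1 hm Finset.univ s (Finset.mem_univ s) o (Finset.mem_univ o) Z Z hZU hZU
    (fun W => W ∈ R) (fun W hW => hR W hW) (connIndicatorFn s b) (monotone_connIndicatorFn s b)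
    (connIndicatorFn_nonneg s b)
  rw [Set.inter_self, Set.union_self, hDD, hFF] at key
  simp only [hC, connIndicatorFn_eq_ind] at key
  -- read the four sums as measures of events
  have e1 : ∑ ω, weight w' ω * (ind F ω * ind D ω) = (prodBernoulli w).real (D ∩ F) := by
    rw [real_eq_sum_weight_ind]
    exact Finset.sum_congr rfl fun ω _ => by rw [ind_inter]; ring
  have e2 : ∑ ω, weight w' ω * (ind (openConn s b : Set (Set (Sym2 V))) ω * ind D ω) =
      (prodBernoulli w).real (D ∩ openConn s b) := by
    rw [real_eq_sum_weight_ind]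
    exact Finset.sum_congr rfl fun ω _ => by rw [ind_inter]; ring
  have e3 : ∑ ω, weight w' ω * (ind F ω * ind (openConn s b : Set (Set (Sym2 V))) ω * ind D ω) =
      (prodBernoulli w).real (D ∩ F ∩ openConn s b) := by
    rw [real_eq_sum_weight_ind]
    exact Finset.sum_congr rfl fun ω _ => by rw [ind_inter, ind_inter]; ring
  have e4 : ∑ ω, weight w' ω * ind D ω = (prodBernoulli w).real D := by rw [real_eq_sum_weight_ind]
  rw [e1, e2, e3, e4] at key
  linarith [key]

end

end PocketBHK

/-- **Registered sub-goal `stub_pocketCovariance_k9` of `stub_goodStep` (siege k9): pocket-augmented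
conditional association, event form** (= `PocketBHK.pocket_cov_event`): for `μ = prodBernoulli w`,
pockets `R` (each member contains `o`, avoids `s` and `Z`), `D = {s ↮ Z}`,
`F = {o ↔ s} ∪ {C(o) ∈ R}`: `μ(D ∩ F) μ(D ∩ {s ↔ b}) ≤ μ(D) μ(D ∩ F ∩ {s ↔ b})`.  The instances
`(s, Z) = (a₁, {a₂})` and `(a₂, {a₁})` are the lead's H1/H2, which give the kernel C1 of `stub_goodStep`.
[folklore] -/
theorem stub_pocketCovariance_k9 : ∀ (V : Type) [Fintype V] (w : Sym2 V → unitInterval) (s o b : V)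
    (Z : Set V) (R : Set (Set V)), (∀ W ∈ R, o ∈ W ∧ s ∉ W ∧ ∀ z ∈ Z, z ∉ W) →
    (Literature.Probability.LatticeModels.prodBernoulli w).real
        ({ω : Set (Sym2 V) | ∀ z ∈ Z, ¬ (Literature.Probability.Percolation.openGraph ω).Reachable s z} ∩
          {ω : Set (Sym2 V) | (Literature.Probability.Percolation.openGraph ω).Reachable o s ∨
            Literature.Probability.Percolation.openCluster ω o ∈ R}) *
      (Literature.Probability.LatticeModels.prodBernoulli w).real
        ({ω : Set (Sym2 V) | ∀ z ∈ Z, ¬ (Literature.Probability.Percolation.openGraph ω).Reachable s z} ∩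
          Literature.Probability.Percolation.openConn s b) ≤
    (Literature.Probability.LatticeModels.prodBernoulli w).real
        {ω : Set (Sym2 V) | ∀ z ∈ Z, ¬ (Literature.Probability.Percolation.openGraph ω).Reachable s z} *
      (Literature.Probability.LatticeModels.prodBernoulli w).real
        ({ω : Set (Sym2 V) | ∀ z ∈ Z, ¬ (Literature.Probability.Percolation.openGraph ω).Reachable s z} ∩
          {ω : Set (Sym2 V) | (Literature.Probability.Percolation.openGraph ω).Reachable o s ∨
            Literature.Probability.Percolation.openCluster ω o ∈ R} ∩
          Literature.Probability.Percolation.openConn s b) :=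
  fun _ _ w s o b Z R hR => PocketBHK.pocket_cov_event w s o b Z R hR

end Summit.CriticalPhenomena.PercolationContinuityZ3.Theorems
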